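import Summits.FinalStateConjecture.FinalStateConjecture.Theorems.ZeroEnergyKerrOrBombSymplecticDualOfTheBombDefs2
import HarnessLib

/-!
# Route ZeroEnergyKerrOrBomb · crux `StationaryLimitReduction` — the seven registered stub STATEMENTS of the
# line `symplectic-dual-of-the-bomb`, reshape r3 (`Sig.stub_*`, `Prop`-valued definitions; nothing is asserted)

Companion of the two Defs modules (`…SymplecticDualOfTheBombDefs.lean` p101414, `…Defs2.lean`): §1 of the
checked skeleton `Cruxes/StationaryLimitReduction/Lines/symplectic_dual_of_the_bomb.lean` (crux
stmt-FinalStateConjecture-10021, `ZeroEnergyKerrOrBomb.StationaryLimitReduction := KerrOrBomb →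
FinalStateConjecture`; reshape r3 by lead prover-line-stmt-FinalStateConjecture-10021-a1-0 after wave 1), so that
the registered stubs `theorem stub_X : Sig.stub_X` and their helpers can land as `Theorems/…` files importing
their statements. Each `Sig.stub_X` is a DEFINITION of a proposition (the text a stub worker must prove or
refute), with the WHY-PLAUSIBLY-TRUE / WHY-IT-MIGHT-FAIL / wave-1 notes kept in the docstrings; none is a
route item, none is asserted, and the module does not import the route file `Theses.ZeroEnergyKerrOrBomb`.
Provenance of each statement is given in prose as `(ref: Key, locator)` (NOT as a `[cite …]` tag: these are the
line's own registered stub statements — obligations, not cited published facts — so the gate must not relocate them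
to `Literature/`; precedent `Summits/ABC/ABC/Theorems/TwistAmplificationMazurKaneLawToolkitDefs.lean`).
-/

-- every `Summit.FinalStateConjecture.FinalStateConjecture.…` name repeats the summit = sub-problem segment (D-0017 layout)
set_option linter.dupNamespace false

noncomputable section

open scoped Manifold ContDiff Topology BigOperators
open Set Filter Bundle MeasureTheory Literature.Geometry.Lorentzian

namespace Summit.FinalStateConjecture.FinalStateConjecture.Theorems.SymplecticDualOfTheBomb

open Summit.FinalStateConjecture.FinalStateConjecture.Theorems.OneLockedExplosion

/-! ## §1 The seven stub statements of reshape r3 (precise `Prop`s `Sig.stub_<name>`; the REGISTERED stubs of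
the skeleton are `theorem stub_<name> : Sig.stub_<name>`) -/

/-- **Stub 1R · `kerrIsometryRigidity` (r3)** — the abstract Kerr isometry of a charted, `I⁺`-regular
telescope hole read in a horizon-covering, asymptotically Cartesian AND asymptotically Schwarzschildean
immersed adapted chart is a `T`-equivariant horizon-regular asymptotically controlled identification
`IsKerrChartedWith`. Wave 1: the r1 statement is FALSE without `I⁺`-regularity (Schwarzschild minus the
closed future of one horizon generator: telescope hole, collar clause fails) and cannot give a bounded
tilt without a rate; step (iii) (`Θ := A⁻¹ ∘ Φ` from a charted extension `Φ`) is landed,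
`isKerrCharted_of_chartedExtension` (p104678). REMAINS (absent from the tree): the Killing algebra of
sub-extremal Kerr (`Ψ^*T = λ∂_{t*}`), the Boyer–Lindquist reflection as an isometry of `Kerr.exterior`,
the horizon extension of a future-preserving `T`-equivariant d.o.c. isometry under `I⁺`-regularity
(Chruściel–Costa §4), and asymptotic rigidity of `Θ` at `i⁰`. (ref: ChruscielCosta2008, Thm. 1.3) -/
def Sig.stub_kerrIsometryRigidity : Prop :=
  ∀ (𝓑 : StationaryAFBlackHole.{0}) (A : 𝓑.AdaptedChart), InTelescope 𝓑 → 𝓑.IsIPlusRegular →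
    𝓑.horizon ⊆ Set.range A.toFun → ChartIsAsymptoticallyCartesian A →
      ChartIsAsymptoticallySchwarzschildean A → IsKerrExterior 𝓑 →
        ∃ (M a c r₀ : ℝ) (Θ : E4 → E4), IsKerrChartedWith 𝓑 A M a c r₀ Θ

/-- **Stub 1F · `chartTransfer` (r3 = the analytic/bookkeeping half `F_an`)** — given a `C²` stationary
decomposition `d` in the D.O.C. SENSE (exterior from `docCharted`, `HasExhaustiveDocCharts`,
horizon-normalised), regular holes, Kerr identifications `Θᵢ` WITH asymptotic control
(`IsKerrChartedWith`), and the causal covering clauses of the recut (`KerrSchildRecutCovering`, the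
output of stub `recutCovering`): the summit's Kerr–Schild `FinalStateDecomposition d'` of some
`O' = exteriorOf 𝒟 d'.charted`, sub-extremal, with exhaustive charts — by the NAIVE RECUT
`chart'ᵢ := ψᵢ ∘ recutMap Θᵢ`, flat chart kept. Landed pieces (wave 1): near-zone convergence every `R`
(`tendsto_truncDeviationCk_readapt`, p113031), separation (`separation_transfer`), excision/flat-domain
(`excision_transfer`, p104896), late-chart clause modulo tilt + image (`isLateChart_conj`), open
embedding of `Θ|exterior` (p109014), `N = 0` case (`chartTransfer_of_N_eq_zero`). (ref: DafermosLuk2017, Conjecture 1) -/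
def Sig.stub_chartTransfer : Prop :=
  ∀ (X : Type) [TopologicalSpace X] [ChartedSpace E3 X] [IsManifold (𝓡 3) ∞ X]
    [T2Space X] [SecondCountableTopology X] [ConnectedSpace X] (D : InitialDataSet (𝓡 3) X)
    (𝒟 : VacuumCauchyDevelopment D) (O : Set 𝒟.carrier)
    (d : StationaryFinalStateDecomposition 𝒟.toSpacetime O 2)
    (M a c r₀ : Fin d.N → ℝ) (Θ : Fin d.N → E4 → E4),
    O = Summit.FinalStateConjecture.exteriorOf 𝒟.toCauchyDevelopment (docCharted d) →
    HasExhaustiveDocCharts d → IsHorizonNormalised d →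
    (∀ i, (d.hole i).horizon ⊆ Set.range (d.adapted i).toFun ∧
      ChartIsAsymptoticallyCartesian (d.adapted i) ∧ InTelescope (d.hole i)) →
    (∀ i, IsKerrChartedWith (d.hole i) (d.adapted i) (M i) (a i) (c i) (r₀ i) (Θ i)) →
    KerrSchildRecutCovering 𝒟 d M a Θ →
    ∃ (O' : Set 𝒟.carrier) (d' : FinalStateDecomposition 𝒟.toSpacetime O' 2),
      (∀ i, Kerr.IsSubextremal (d'.mass i) (d'.spin i)) ∧
        O' = Summit.FinalStateConjecture.exteriorOf 𝒟.toCauchyDevelopment d'.charted ∧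
          Summit.FinalStateConjecture.HasExhaustiveCharts d'

/-- **Stub 1G · `recutCovering` (new in r3; the causal half, D3 of the chartTransfer worker)** — under the
same hypotheses as `stub_chartTransfer` minus its last one, the causal covering clauses of the naive
recut hold for some late time and some growing radii (`KerrSchildRecutCovering`): a JUNCTION property of
the flat and Kerr–Schild slab families on the overlap annuli plus the near-horizon causal comparison
(red-shift region) using horizon normalisation, and the transfer of `C²` convergence to GROWING radii
through the asymptotically controlled `Θᵢ`. Nothing of this is in the tree or in print (the summit's own
covering clauses are asserted, never derived). (ref: DafermosLuk2017, Conjecture 1 (b)–(c)) -/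
def Sig.stub_recutCovering : Prop :=
  ∀ (X : Type) [TopologicalSpace X] [ChartedSpace E3 X] [IsManifold (𝓡 3) ∞ X]
    [T2Space X] [SecondCountableTopology X] [ConnectedSpace X] (D : InitialDataSet (𝓡 3) X)
    (𝒟 : VacuumCauchyDevelopment D) (O : Set 𝒟.carrier)
    (d : StationaryFinalStateDecomposition 𝒟.toSpacetime O 2)
    (M a c r₀ : Fin d.N → ℝ) (Θ : Fin d.N → E4 → E4),
    O = Summit.FinalStateConjecture.exteriorOf 𝒟.toCauchyDevelopment (docCharted d) →
    HasExhaustiveDocCharts d → IsHorizonNormalised d →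
    (∀ i, (d.hole i).horizon ⊆ Set.range (d.adapted i).toFun ∧
      ChartIsAsymptoticallyCartesian (d.adapted i) ∧ InTelescope (d.hole i)) →
    (∀ i, IsKerrChartedWith (d.hole i) (d.adapted i) (M i) (a i) (c i) (r₀ i) (Θ i)) →
    KerrSchildRecutCovering 𝒟 d M a Θ

/-- **Stub 2 · `nonSettlingCure` (r3)** — the global half: data that do not settle regularly IN THE D.O.C.
SENSE, or that settle with an MGHD carrying a local Killing germ at EVERY point of the slice (no
germ-KID-free point: e.g. axisymmetric exceptional data, for which the kick/detector mechanism of stubs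
4–5 has no base point), are curable: a jointly smooth admissible family `F`, `F 0 = D`, injective for
`|c₀| < ε`, whose members `0 < |c₀| < ε` settle in the d.o.c. sense to MODE-STABLE regular holes
(`SettlesDocWith ModeStable`). SIZE: open problem (weak cosmic censorship in Christodoulou's instability
form + large-data settling + a dynamical third law + no-parking + `I⁺`-regularity and rates of the limits,
now also the curing of symmetric exceptional data) — owed by every stationary-limit line; kept as ONE
curve statement (Disproof §5). In this tree no MGHD of any datum is constructible (`MGHDExists` named),
so neither side is certifiable today. (ref: DafermosLuk2017, §1.2.1) -/
def Sig.stub_nonSettlingCure : Prop :=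
  ∀ (X : Type) [TopologicalSpace X] [ChartedSpace E3 X] [IsManifold (𝓡 3) ∞ X]
    [T2Space X] [SecondCountableTopology X] [ConnectedSpace X],
    ∀ D ∈ admissibleVacuumData X,
      (¬ SettlesDocWith (fun _ ↦ True) X D ∨
        ∃ 𝒟 : VacuumCauchyDevelopment D, 𝒟.IsMaximal ∧ ∀ x : X, ¬ IsKIDFreeAt 𝒟 x) →
      ∃ (ε : ℝ) (F : EuclideanSpace ℝ (Fin 1) → InitialDataSet (𝓡 3) X), 0 < ε ∧
        InitialDataSet.IsSmoothDataFamily 1 F ∧ F 0 = D ∧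
        (∀ c c' : EuclideanSpace ℝ (Fin 1), |c 0| < ε → |c' 0| < ε → F c = F c' → c = c') ∧
        (∀ c : EuclideanSpace ℝ (Fin 1), |c 0| < ε → F c ∈ admissibleVacuumData X) ∧
        ∀ c : EuclideanSpace ℝ (Fin 1), c ≠ 0 → |c 0| < ε → SettlesDocWith ModeStable X (F c)

/-- **Stub 3 · `probeUniversality` (unchanged)** — the Bridge: a regular hole with a horizon-covering
adapted chart which is NOT Killing-mode-stable for `□_g` carries a growing GRAVITATIONAL Killing-mode pair
(`IsGravitationalModePair`, p101414). Wave 1: no junk either way (p104705: zero/gauge/stationary pairs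
excluded, outgoing region never vacuous, `probeUniversality_iff_bridge`); NONE-EXISTS — no printed theorem
maps scalar growing modes to tensor ones on a general stationary vacuum hole (`ScalarToTensorModeBridge`
≡ this stub); vacuously implied by smooth no-hair (`probeUniversality_of_forall_modeStable`).
(ref: ShlapentokhRothman2015ModeStability, §1.3 and Thm. 1.5) -/
def Sig.stub_probeUniversality : Prop :=
  ∀ (𝓑 : StationaryAFBlackHole.{0}) (A : 𝓑.AdaptedChart), InTelescope 𝓑 →
    𝓑.horizon ⊆ Set.range A.toFun → ¬ ModeStable 𝓑 →
      ∃ (ν ϖ : ℝ) (h₁ h₂ : HoleBilinField 𝓑), 0 < ν ∧ IsGravitationalModePair 𝓑 A ν ϖ h₁ h₂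

/-- **Stub 4 · `moncriefFacts` (r3; replaces `moncriefTransversality`, whose corrected form is PROVED from
these two facts: `stub_moncriefTransversality_of_localDeformation`, p105738)** — the two printed inputs of
the lever, as the cited predicates landed in p105738: (a) LOCAL CONSTRAINT DEFORMATION off germ-KIDs
(Corvino–Schoen gr-qc/0301071, Chruściel–Delay Mém. SMF 94 (2003): compactly supported solutions of the
vacuum constraints near an admissible KID-free germ exponentiate any finite set of compactly supported
linearised solutions, up to a common non-zero factor) and (b) LOCAL MONCRIEF DUALITY (Moncrief 1975,
Fischer–Marsden–Moncrief 1980, localised: symmetric detectors independent modulo local gauge pair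
non-degenerately with compactly supported linearised solutions). Both are theorems in print up to the
localisation to a ball (closed range of `J∘DΦ*` on `𝓓′(U)`), not in the tree. (ref: Wald1984GR, Appendix E.2) -/
def Sig.stub_moncriefFacts : Prop :=
  (∀ (X : Type) [TopologicalSpace X] [ChartedSpace E3 X] [IsManifold (𝓡 3) ∞ X]
      [T2Space X] [SecondCountableTopology X] [ConnectedSpace X] (D : InitialDataSet (𝓡 3) X)
      (𝒟 : VacuumCauchyDevelopment D) (x₀ : X), LocalConstraintDeformationAt 𝒟 x₀) ∧
    ∀ (X : Type) [TopologicalSpace X] [ChartedSpace E3 X] [IsManifold (𝓡 3) ∞ X]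
      [T2Space X] [SecondCountableTopology X] [ConnectedSpace X] (D : InitialDataSet (𝓡 3) X)
      (𝒟 : VacuumCauchyDevelopment D) (x₀ : X), LocalMoncriefDualityAt 𝒟 x₀

/-- **Stub 5 · `dualModeEjection` (r3)** — the symplectic dual of the bomb detects at a germ-KID-free point,
and transversal steerable families escape: for an admissible `D`, an MGHD with complete `𝓘⁺` and a `C²`
stationary decomposition IN THE D.O.C. SENSE (exterior from `docCharted`, `HasExhaustiveDocCharts`,
horizon-normalised, regular holes as in `SettlesDocWith`) whose hole `i` carries a growing gravitational
Killing-mode pair, and which HAS a germ-KID-free point: there are a germ-KID-free point `x₀` and finitely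
many SYMMETRIC detectors at `x₀` (`AreSymmDetectorsAt`) such that every jointly smooth admissible
`k`-family through `D` supported in the chart source at `x₀` with non-degenerate pairing matrix contains a
jointly smooth locally injective curve all of whose members `0 < |c₀| < ε` settle (d.o.c. sense) to
MODE-STABLE regular holes. Wave 1 (p104819): the r1 text collapsed (antisymmetric detectors; KID-freeness
on the conclusion side = global no-KID, false for symmetric bombs). Debts (all absent): dual-mode
transport by the conserved symplectic current + local non-gauge-ness of the dual mode at some KID-free
point, the saddle (isolated growing eigenvalue, strong-unstable shadowing) and the fate of the explosion.
(ref: DafermosLuk2017, §1.2.1) -/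
def Sig.stub_dualModeEjection : Prop :=
  ∀ (X : Type) [TopologicalSpace X] [ChartedSpace E3 X] [IsManifold (𝓡 3) ∞ X]
    [T2Space X] [SecondCountableTopology X] [ConnectedSpace X],
    ∀ D ∈ admissibleVacuumData X, ∀ (𝒟 : VacuumCauchyDevelopment D), 𝒟.IsMaximal →
      Summit.FinalStateConjecture.HasCompleteNullInfinity 𝒟.toCauchyDevelopment →
      ∀ (O : Set 𝒟.carrier) (d : StationaryFinalStateDecomposition 𝒟.toSpacetime O 2),
        O = Summit.FinalStateConjecture.exteriorOf 𝒟.toCauchyDevelopment (docCharted d) →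
        HasExhaustiveDocCharts d → IsHorizonNormalised d →
        (∀ i, (d.hole i).horizon ⊆ Set.range (d.adapted i).toFun ∧
          ChartIsAsymptoticallyCartesian (d.adapted i) ∧
            ChartIsAsymptoticallySchwarzschildean (d.adapted i) ∧
              InTelescope (d.hole i) ∧ (d.hole i).IsIPlusRegular) →
        ∀ (i : Fin d.N) (ν ϖ : ℝ) (h₁ h₂ : HoleBilinField (d.hole i)), 0 < ν →
          IsGravitationalModePair (d.hole i) (d.adapted i) ν ϖ h₁ h₂ →
          (∃ x : X, IsKIDFreeAt 𝒟 x) →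
          ∃ (x₀ : X) (k : ℕ) (A B : Fin k → BilinField X), AreSymmDetectorsAt 𝒟 x₀ A B ∧
            ∀ G : EuclideanSpace ℝ (Fin k) → InitialDataSet (𝓡 3) X,
              InitialDataSet.IsSmoothDataFamily k G → G 0 = D → (∀ c, G c ∈ admissibleVacuumData X) →
              (∃ K : Set X, IsCompact K ∧ K ⊆ (extChartAt (𝓡 3) x₀).source ∧ IsSupportedIn D G K) →
              (pairingMatrix D x₀ A B G).det ≠ 0 →
              ∃ (ε : ℝ) (F : EuclideanSpace ℝ (Fin 1) → InitialDataSet (𝓡 3) X), 0 < ε ∧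
                InitialDataSet.IsSmoothDataFamily 1 F ∧ F 0 = D ∧
                (∀ c, ∃ c', F c = G c') ∧
                (∀ c c' : EuclideanSpace ℝ (Fin 1), |c 0| < ε → |c' 0| < ε → F c = F c' → c = c') ∧
                ∀ c : EuclideanSpace ℝ (Fin 1), c ≠ 0 → |c 0| < ε → SettlesDocWith ModeStable X (F c)

/-- Read-back of `Sig.stub_moncriefFacts` (definitional). Registration device of this module. [folklore] -/
theorem sig_stub_moncriefFacts_iff : Sig.stub_moncriefFacts ↔ (∀ (X : Type) [TopologicalSpace X] [ChartedSpace E3 X] [IsManifold (𝓡 3) ∞ X] [T2Space X] [SecondCountableTopology X] [ConnectedSpace X] (D : InitialDataSet (𝓡 3) X) (𝒟 : VacuumCauchyDevelopment D) (x₀ : X), LocalConstraintDeformationAt 𝒟 x₀) ∧ ∀ (X : Type) [TopologicalSpace X] [ChartedSpace E3 X] [IsManifold (𝓡 3) ∞ X] [T2Space X] [SecondCountableTopology X] [ConnectedSpace X] (D : InitialDataSet (𝓡 3) X) (𝒟 : VacuumCauchyDevelopment D) (x₀ : X), LocalMoncriefDualityAt 𝒟 x₀ :=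
  Iff.rfl

end Summit.FinalStateConjecture.FinalStateConjecture.Theorems.SymplecticDualOfTheBomb

end
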